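import Mathlib

/-!
# Line `Sketch` for crux `FidelityWitnesses.FidelityThesis` (stmt-MatrixMultiplication-4956) —
stub `stub_parabolaSum`: the parabola change of variables on `𝔽_N × 𝔽_N`

For an odd prime `N` and any `F : 𝔽_N → 𝔽_N → ℝ`, the map `(k, k') ↦ (k' − k, k'² − k²)` sends the
diagonal `k = k'` (`N` pairs) to `(0, 0)` and is a bijection from the off-diagonal onto
`{(s, t) : s ≠ 0}`.  Hence `∑_{k,k'} F(k' − k, k'² − k²) = N·F(0,0) + ∑_{s ≠ 0} ∑_t F(s,t)`.

Proof: substitute `s = k' − k` in the inner sum (`k'² − k² = s (s + 2k)`), swap the sums, split off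
`s = 0` (giving `N · F 0 0`), and for `s ≠ 0` the affine map `k ↦ s (s + 2k)` is injective (as `2s ≠ 0`
in `𝔽_N`, `N ≠ 2`), hence a bijection of the finite set `𝔽_N`.
Supports item `stmt-MatrixMultiplication-4956`; Mathlib only, no definitions.
-/

namespace Summit.MatrixMultiplication.MatrixMultiplication.Theorems

open scoped BigOperators

/-- **Parabola sum.** For an odd prime `N` and `F : ZMod N → ZMod N → ℝ`,
`∑_{k,k'} F (k' - k) (k'² - k²) = N · F 0 0 + ∑_{s ≠ 0} ∑_t F s t`: the substitution
`(s, t) = (k' - k, k'² - k²)` collapses the diagonal onto `(0,0)` and is a bijection from the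
off-diagonal onto `{s ≠ 0} × ZMod N`. [folklore] -/
theorem stub_parabolaSum {N : ℕ} [Fact (Nat.Prime N)] (hN : N ≠ 2) (F : ZMod N → ZMod N → ℝ) :
    ∑ k : ZMod N, ∑ k' : ZMod N, F (k' - k) (k' ^ 2 - k ^ 2) =
      (N : ℝ) * F 0 0 + ∑ s ∈ (Finset.univ : Finset (ZMod N)).erase 0, ∑ t : ZMod N, F s t := by
  classical
  -- `2 ≠ 0` in `ZMod N` since the characteristic `N` is a prime different from `2`
  have h2 : (2 : ZMod N) ≠ 0 := Ring.two_ne_zero (by rwa [ZMod.ringChar_zmod_n])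
  -- substitute `s = k' - k` in the inner sum: `k' ^ 2 - k ^ 2 = s * (s + 2 * k)`
  have step : ∀ k : ZMod N, ∑ k' : ZMod N, F (k' - k) (k' ^ 2 - k ^ 2) =
      ∑ s : ZMod N, F s (s * (s + 2 * k)) := by
    intro k
    refine Fintype.sum_equiv (Equiv.subRight k) _ _ fun k' => ?_
    simp only [Equiv.subRight_apply]
    congr 1
    ring
  simp_rw [step]
  rw [Finset.sum_comm, ← Finset.add_sum_erase Finset.univ _ (Finset.mem_univ (0 : ZMod N))]
  congr 1
  · -- the diagonal: `N` copies of `F 0 0`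
    simp [Finset.sum_const, Finset.card_univ, ZMod.card]
  · -- off the diagonal: for `s ≠ 0`, `k ↦ s * (s + 2 * k)` is a bijection of `ZMod N`
    refine Finset.sum_congr rfl fun s hs => ?_
    have hs0 : s ≠ 0 := Finset.ne_of_mem_erase hs
    have hinj : Function.Injective (fun k : ZMod N => s * (s + 2 * k)) := by
      intro a b hab
      exact mul_left_cancel₀ h2 (add_left_cancel (mul_left_cancel₀ hs0 hab))
    exact hinj.bijective_of_finite.sum_comp (F s)

end Summit.MatrixMultiplication.MatrixMultiplication.Theorems
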